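import Literature.MathematicalPhysics.QuantumFieldTheory.LatticeYangMillsClusteringTransfer
import Literature.MathematicalPhysics.QuantumFieldTheory.Balaban1983to89.TraceWordsSeparateOrbitsOrthogonal
import HarnessLib

/-!
# Shen–Zhu–Zhu for the structure group `SO(N)`: uniqueness of the infinite-volume limit
# (Theorem 1.2 (2)), log-Sobolev / Poincaré inequalities (Theorem 1.4 = Corollary 4.5) and mass gap
# (Corollary 1.6 / Corollary 4.11), with the `SO(N)` constants `K_𝒮 = (N+2)/4 - 1 - 8N|β|(d-1)`,
# `|β| < 1/(32(d-1)) - 1/(16N(d-1))` (CMP 400 (2023) 805–851 = arXiv:2204.12737)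

Shen–Zhu–Zhu prove all their results for `G ∈ {SO(N), SU(N)}` ("We write `G` for the Lie group `SO(N)`
or `SU(N)`", §1.1). The tree had typed (and largely proved) the `SU(N)` case only:
`shenZhuZhu_functionalInequalities` / `SZZFunctionalInequalitiesWith` (Theorem 1.4, Lipschitz form,
`ShenZhuZhuLogSobolev`, `LatticeYangMillsBakryEmery`), `SZZExponentialClustering` /
`shenZhuZhu_massGap_tightLimits` (Corollary 4.11, `LatticeYangMillsClusteringTransfer`, proved), and
`shen_zhu_zhu` (Theorem 1.2 + Corollary 1.6 in DLR form, proved). This file types the `SO(N)` case —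
`SO(N)` = real orthogonal matrices of determinant one read in `M_N(ℂ)`, the tree's
`specialOrthogonalRep (Fin N) : SO(N) →* M_N(ℂ)` (compact group, continuous faithful unitary
representation; 't Hooft coupling `β`, tree coupling `Nβ` as for `SU(N)`) — through
representation-generic CONCLUSION shapes that specialise DEFINITIONALLY to the existing `SU(N)` ones
(`SZZFunctionalInequalitiesRep (fundamentalRep (Fin N)) … ↔ SZZFunctionalInequalitiesWith …`,
`SZZExponentialClusteringRep (fundamentalRep (Fin N)) … ↔ SZZExponentialClustering …`, both `Iff.rfl`),
and Theorem 1.2 (2) (uniqueness of the tight limit and convergence of the whole sequence) for both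
groups in the `ℤ^d` vocabulary of `LatticeGaugeDLR`.

Numbers are those of arXiv:2204.12737v1 (checked against the LaTeX source).

* **Theorem 1.2 (2)** (`shenZhuZhu_uniqueLimit d N`): under Assumption 1.1 "every tight limit of
  `{μ_{Λ_L,N,β}}_L` is the same, and the whole sequence converges" — `SU(N)` ∧ `SO(N)`. The `SU(N)`
  subsingleton half is also PROVED here from the tree (`subsingleton_infiniteVolumeLimitPoints_SU`,
  via `shen_zhu_zhu_holds`), as a consistency check.
* **Theorem 1.4 = Corollary 4.5, `SO(N)`** (`shenZhuZhu_functionalInequalities_SO d N`): (1.9)–(1.10)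
  `Ent_μ(F²) ≤ (2/K_𝒮) Σ_e μ(|∇_e F|²)`, `Var_μ(F) ≤ (1/K_𝒮) Σ_e μ(|∇_e F|²)` for every tight limit `μ`,
  in the Lipschitz form of `ShenZhuZhuLogSobolev` (a smooth cylinder function `L_e`-Lipschitz in the
  link `e` for the Frobenius = Hilbert–Schmidt distance has `|∇_e F| ≤ L_e`, chords ≤ arcs).
* **Corollary 1.6 / Corollary 4.11, `SO(N)`** (`shenZhuZhu_massGap_SO d N`): exponential clustering
  `Cov(f,g) ≤ c₁ d(𝔤) e^{-c_N d(Λ_f,Λ_g)}(⦀f⦀_∞⦀g⦀_∞ + ‖f‖_{L²}‖g‖_{L²})` for every tight limit, in the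
  Lipschitz-cylinder rendering of the tree's `SZZExponentialClustering`.

**Flags (faithfulness).** (a) As for `SU(N)`: the gradient form of (1.9)–(1.10) needs the Dirichlet
form on `SO(N)^Λ` and is rendered by per-link Lipschitz constants; `⦀f⦀_∞` likewise, with the
support-size dependence of `c₁` explicit (`∀ n ∃ c₁`). (b) For `SO(N)` Assumption 1.1 is typed in
its equivalent form (1.3), `|β| < szzThresholdSO N d`, with `N ≥ 1`, `d ≥ 2` (for `N ≤ 2` the window
is empty, as in print: `K_𝒮 ≤ 0`). (c) Theorem 1.2 (2) is rendered as: the set of infinite-volume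
limit points is a subsingleton and the full sequence of torus states has a limit
(`IsInfiniteVolumeLimit`); parts (1), (3) (infinite-volume semigroup) are in `ShenZhuZhuErgodicity`'s
scope notes (not typed).

## References

* H. Shen, R. Zhu, X. Zhu, CMP 400 (2023) 805–851 = arXiv:2204.12737v1: §1.1 (structure groups),
  Assumption 1.1 / (1.3) p. 4, Theorem 1.2 p. 5, Theorem 1.4 (1.8)–(1.10) p. 6, Corollary 1.6 p. 7,
  Corollary 4.5 (4.12)–(4.13) p. 20, Corollary 4.11 (p. 28) [ShenZhuZhuCMP2023].
-/

noncomputable section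

open MeasureTheory ProbabilityTheory
open scoped NNReal Matrix.Norms.Frobenius ContDiff
open Literature.MathematicalPhysics.QuantumLattice
open Literature.MathematicalPhysics.QuantumFieldTheory.Balaban1983to89.TraceWordsSeparateOrbitsOrthogonal
  (specialOrthogonalRep)

namespace Literature.MathematicalPhysics.QuantumFieldTheory

/-! ### Representation-generic conclusion shapes -/

section Shapes

variable {d N : ℕ} {G : Type*} [Group G] [TopologicalSpace G] [IsTopologicalGroup G] [CompactSpace G]
  [MeasurableSpace G] [BorelSpace G] (ρ : G →* Matrix (Fin N) (Fin N) ℂ)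

/-- The cylinder observable `F(U) = f((Q_e)_{e∈Λ})`, `Q_e = ρ(U_e)`, from a function `f` of the link
matrices over the finite edge set `Λ` (SZZ's `C^∞_cyl`, (1.8)); for `ρ = fundamentalRep (Fin N)` this
is `matrixCylinder Λ f` (definitionally). [cite: ShenZhuZhuCMP2023, (1.8)] -/
def repCylinder (Λ : Finset (ZdEdge d)) (f : (↥Λ → Matrix (Fin N) (Fin N) ℂ) → ℝ) :
    LGConfig d G → ℝ :=
  fun U => f fun e => ρ (U e)

/-- `repCylinder (fundamentalRep (Fin N)) = matrixCylinder`. [cite: ShenZhuZhuCMP2023, (1.8)] -/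
theorem repCylinder_fundamentalRep (Λ : Finset (ZdEdge d)) (f : (↥Λ → Matrix (Fin N) (Fin N) ℂ) → ℝ) :
    repCylinder (fundamentalRep (Fin N)) Λ f = matrixCylinder Λ f := rfl

variable (d) in
/-- The CONCLUSION of Corollary 4.5 ((4.12)–(4.13) = Theorem 1.4 (1.9)–(1.10)) with constant `K` at
tree coupling `β'`, Lipschitz form, for a general structure group `ρ(G) ⊆ M_N(ℂ)`: for every
infinite-volume limit point `μ` of the torus Wilson states and every smooth cylinder function
`F = f((ρ U_e)_{e∈Λ})` that is `L_e`-Lipschitz in the link `e` for the Frobenius (Hilbert–Schmidt,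
(2.3)) distance `‖ρ(a) - ρ(b)‖_F`, `Ent_μ(F²) ≤ (2/K) Σ_e L_e²` and `Var_μ(F) ≤ (1/K) Σ_e L_e²`. For
`ρ = fundamentalRep (Fin N)` this is `SZZFunctionalInequalitiesWith d N β K` with `β' = Nβ`
(`szzFunctionalInequalitiesRep_fundamentalRep_iff`). [cite: ShenZhuZhuCMP2023, Corollary 4.5] -/
def SZZFunctionalInequalitiesRep (β' K : ℝ) : Prop :=
  ∀ μ ∈ infiniteVolumeLimitPoints (d := d) ρ β',
    ∀ (Λ : Finset (ZdEdge d)) (f : (↥Λ → Matrix (Fin N) (Fin N) ℂ) → ℝ) (L : ↥Λ → ℝ),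
      ContDiff ℝ ∞ f → (∀ e, 0 ≤ L e) →
      (∀ (e : ↥Λ) (M M' : ↥Λ → G), (∀ e', e' ≠ e → M e' = M' e') →
          |f (fun e' => ρ (M e')) - f (fun e' => ρ (M' e'))| ≤ L e * frobNorm (ρ (M e) - ρ (M' e))) →
      (∫ U, repCylinder ρ Λ f U ^ 2 * Real.log (repCylinder ρ Λ f U ^ 2) ∂μ -
          (∫ U, repCylinder ρ Λ f U ^ 2 ∂μ) * Real.log (∫ U, repCylinder ρ Λ f U ^ 2 ∂μ)
            ≤ 2 / K * ∑ e, L e ^ 2) ∧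
      (Var[repCylinder ρ Λ f; μ] ≤ 1 / K * ∑ e, L e ^ 2)

/-- **Consistency**: at `ρ = fundamentalRep (Fin N)` the generic shape IS the tree's `SU(N)` shape
`SZZFunctionalInequalitiesWith` (definitionally: `suFrobDist a b = ‖a - b‖_F`, `matrixCylinder`).
[cite: ShenZhuZhuCMP2023, Corollary 4.5] -/
theorem szzFunctionalInequalitiesRep_fundamentalRep_iff (β K : ℝ) :
    SZZFunctionalInequalitiesRep d (fundamentalRep (Fin N)) ((N : ℝ) * β) K ↔
      SZZFunctionalInequalitiesWith d N β K :=
  Iff.rfl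

variable (d) in
/-- The CONCLUSION of Corollary 4.11 at tree coupling `β'` for a general structure group
`ρ(G) ⊆ M_N(ℂ)`, in the Lipschitz-cylinder rendering of the tree's `SZZExponentialClustering` /
`shen_zhu_zhu` (ii): every infinite-volume limit point `μ` has a rate `c > 0` and, for every bound `n`
on the support sizes, a constant `c₁` with
`|Cov_μ(F₁,F₂)| ≤ c₁ e^{-c d(Λ₁,Λ₂)} (K₁K₂ + ‖F₁‖_{L²(μ)}‖F₂‖_{L²(μ)})` for Lipschitz cylinder functions
`Fᵢ` with disjoint supports `Λᵢ`, `|Λᵢ| ≤ n`. For `ρ = fundamentalRep (Fin N)` this is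
`SZZExponentialClustering d N β` (`szzExponentialClusteringRep_fundamentalRep_iff`).
[cite: ShenZhuZhuCMP2023, Corollary 4.11] -/
def SZZExponentialClusteringRep (β' : ℝ) : Prop :=
  ∀ μ ∈ infiniteVolumeLimitPoints (d := d) ρ β',
    ∃ c : ℝ, 0 < c ∧ ∀ n : ℕ, ∃ c₁ : ℝ,
      ∀ (F₁ F₂ : LGConfig d G → ℝ) (Λ₁ Λ₂ : Finset (ZdEdge d)) (K₁ K₂ : ℝ≥0),
        Λ₁.card ≤ n → Λ₂.card ≤ n → Disjoint Λ₁ Λ₂ →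
        IsLipschitzCylinder ρ F₁ Λ₁ K₁ → IsLipschitzCylinder ρ F₂ Λ₂ K₂ →
          |cov[F₁, F₂; μ]| ≤ c₁ * Real.exp (-c * setDistEdges Λ₁ Λ₂) *
            ((K₁ : ℝ) * K₂ + Real.sqrt (∫ U, F₁ U ^ 2 ∂μ) * Real.sqrt (∫ U, F₂ U ^ 2 ∂μ))

/-- **Consistency**: at `ρ = fundamentalRep (Fin N)` the generic shape IS the tree's
`SZZExponentialClustering d N β` (definitionally). [cite: ShenZhuZhuCMP2023, Corollary 4.11] -/
theorem szzExponentialClusteringRep_fundamentalRep_iff (β : ℝ) :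
    SZZExponentialClusteringRep d (fundamentalRep (Fin N)) ((N : ℝ) * β) ↔ SZZExponentialClustering d N β :=
  Iff.rfl

end Shapes

/-! ### The `SO(N)` named facts -/

/-- **Shen–Zhu–Zhu, Theorem 1.4 = Corollary 4.5 for `G = SO(N)`, Lipschitz form** (arXiv:2204.12737v1,
Theorem 1.4 (1.9)–(1.10) p. 6, Corollary 4.5 (4.12)–(4.13) p. 20). "Under Assumption 1.1
[`K_𝒮 = (N+2)/4 - 1 - 8N|β|(d-1) > 0` for `G = SO(N)`], the log-Sobolev inequality holds, i.e. for
cylinder functions `F ∈ C^∞_cyl(𝒬)` with `μ_{N,β}(F²) = 1`, `μ_{N,β}(F² log F²) ≤ (2/K_𝒮) 𝓔^{μ_{N,β}}(F,F)`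
(4.12). This implies the Poincaré inequality … `μ_{N,β}(F²) ≤ (1/K_𝒮) 𝓔^{μ_{N,β}}(F,F) + μ_{N,β}(F)²`
(4.13)", `𝓔^{μ}(F,F) = Σ_{e∈E⁺} ∫ |∇_e F|² dμ` (3.8), for every tight limit `μ_{N,β}` of the periodic
measures (which Theorem 1.2 identifies with `μ^{YM}_{N,β}`, giving Theorem 1.4). Rendered exactly as
the tree's `SU(N)` fact `shenZhuZhu_functionalInequalities` but for `SO(N)` (`specialOrthogonalRep`,
tree coupling `Nβ`, `K_𝒮 = szzBakryEmeryConstSO N d β`, window (1.3) `|β| < szzThresholdSO N d`,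
`d ≥ 2`, `N ≥ 1`): `SZZFunctionalInequalitiesRep d (specialOrthogonalRep (Fin N)) (Nβ) K_𝒮` — the
Lipschitz form of (4.12)–(4.13), implied by the printed gradient form since `|∇_e F| ≤ L_e` for the
Hilbert–Schmidt metric (flag (a)). [cite: ShenZhuZhuCMP2023, Corollary 4.5] -/
def shenZhuZhu_functionalInequalities_SO (d N : ℕ) : Prop :=
  2 ≤ d → 1 ≤ N → ∀ β : ℝ, |β| < szzThresholdSO N d →
    SZZFunctionalInequalitiesRep d (specialOrthogonalRep (Fin N)) ((N : ℝ) * β) (szzBakryEmeryConstSO N d β)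

/-- **Shen–Zhu–Zhu, Corollary 4.11 / Corollary 1.6 ("Mass gap") for `G = SO(N)`** (arXiv:2204.12737v1,
Corollary 1.6 p. 7, Corollary 4.11 p. 28). "Suppose that Assumption 1.1 holds. For
`f, g ∈ C^∞_cyl(𝒬)`, suppose that `Λ_f ∩ Λ_g = ∅`. Then one has
`cov(f,g) ≤ c₁ d(𝔤) e^{-c_N d(Λ_f,Λ_g)}(⦀f⦀_∞⦀g⦀_∞ + ‖f‖_{L²}‖g‖_{L²})`, where `c₁` depends on `|Λ_f|, |Λ_g|`,
and `c_N` depends on `K_𝒮`, `N` and `d`. Here the covariance and `L²` are with respect to every tight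
limit of `{μ_{Λ_L,N,β}}_L`" (Cor. 4.11; Cor. 1.6 is the same for `μ^{YM}_{N,β}`). Rendered exactly as the
tree's `SU(N)` statement `shenZhuZhu_massGap_tightLimits` but for `SO(N)`: `d ≥ 2`, `N ≥ 1`,
`|β| < szzThresholdSO N d`, conclusion `SZZExponentialClusteringRep d (specialOrthogonalRep (Fin N)) (Nβ)`
(Lipschitz seminorms for `⦀·⦀_∞`, flag (a)). [cite: ShenZhuZhuCMP2023, Corollary 4.11] -/
def shenZhuZhu_massGap_SO (d N : ℕ) : Prop :=
  2 ≤ d → 1 ≤ N → ∀ β : ℝ, |β| < szzThresholdSO N d →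
    SZZExponentialClusteringRep d (specialOrthogonalRep (Fin N)) ((N : ℝ) * β)

/-! ### Theorem 1.2 (2): uniqueness of the infinite-volume limit, both structure groups -/

/-- **Shen–Zhu–Zhu, Theorem 1.2 (2)** (uniqueness of the infinite-volume limit; arXiv:2204.12737v1
p. 5, proof p. 36: every tight limit is invariant for (1.6) (Theorem 3.5) and the invariant measure is
unique (Lemma 5.1)). "Under Assumption 1.1 … (2) every tight limit of `{μ_{Λ_L,N,β}}_L` is the same,
and the whole sequence `{μ_{Λ_L,N,β}}_L` converges to `μ^{YM}_{N,β}` as `L → ∞`." Rendered in the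
tree's `ℤ^d` vocabulary (`LatticeGaugeDLR`): the set of infinite-volume limit points of the torus
Wilson states at tree coupling `Nβ` is a subsingleton and the full sequence has a limit
(`IsInfiniteVolumeLimit`), for `d ≥ 2`, `N ≥ 1` and Assumption 1.1 in the form (1.3): first
conjunct `SU(N)` (`fundamentalRep (Fin N)`, `|β| < 1/(16(d-1))`; for `N ≥ 2` the subsingleton half is
also the tree's proved `shen_zhu_zhu`), second conjunct `SO(N)` (`specialOrthogonalRep (Fin N)`,
`|β| < 1/(32(d-1)) - 1/(16N(d-1))`). Parts (1) and (3) of Theorem 1.2 concern the infinite-volume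
semigroup and are not typed (flag (c)). [cite: ShenZhuZhuCMP2023, Theorem 1.2] -/
def shenZhuZhu_uniqueLimit (d N : ℕ) : Prop :=
  (2 ≤ d → 1 ≤ N → ∀ β : ℝ, |β| < szzThresholdSU d →
    (infiniteVolumeLimitPoints (d := d) (fundamentalRep (Fin N)) ((N : ℝ) * β)).Subsingleton ∧
      ∃ μ, IsInfiniteVolumeLimit (d := d) (fundamentalRep (Fin N)) ((N : ℝ) * β) μ) ∧
  (2 ≤ d → 1 ≤ N → ∀ β : ℝ, |β| < szzThresholdSO N d →
    (infiniteVolumeLimitPoints (d := d) (specialOrthogonalRep (Fin N)) ((N : ℝ) * β)).Subsingleton ∧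
      ∃ μ, IsInfiniteVolumeLimit (d := d) (specialOrthogonalRep (Fin N)) ((N : ℝ) * β) μ)

/-- **Consistency with the tree (`SU(N)`, `N ≥ 2`)**: the subsingleton half of the `SU(N)` conjunct of
Theorem 1.2 (2) HOLDS, by the tree's theorem `shen_zhu_zhu_holds` (DLR uniqueness, Dobrushin route)
and `mem_ymGibbsMeasures_of_mem_infiniteVolumeLimitPoints_holds` (tight limits are DLR states).
[cite: ShenZhuZhuCMP2023, Theorem 1.2] -/
theorem subsingleton_infiniteVolumeLimitPoints_SU {d N : ℕ} (hd : 2 ≤ d) (hN : 2 ≤ N) {β : ℝ}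
    (hβ : |β| < szzThresholdSU d) :
    (infiniteVolumeLimitPoints (d := d) (fundamentalRep (Fin N)) ((N : ℝ) * β)).Subsingleton := by
  intro μ hμ ν hν
  haveI : SecondCountableTopology (Matrix (Fin N) (Fin N) ℂ) :=
    inferInstanceAs (SecondCountableTopology (Fin N → Fin N → ℂ))
  haveI : SecondCountableTopology (Matrix.specialUnitaryGroup (Fin N) ℂ) :=
    Topology.IsEmbedding.subtypeVal.secondCountableTopology
  have hβ' : |β| < 1 / (16 * ((d : ℝ) - 1)) := by simpa [szzThresholdSU] using hβ
  have hU := (shen_zhu_zhu_holds d N hd hN β hβ').1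
  exact hU.1
    (mem_ymGibbsMeasures_of_mem_infiniteVolumeLimitPoints_holds (fundamentalRep (Fin N))
      (continuous_fundamentalRep (Fin N)) hμ)
    (mem_ymGibbsMeasures_of_mem_infiniteVolumeLimitPoints_holds (fundamentalRep (Fin N))
      (continuous_fundamentalRep (Fin N)) hν)

/-- The `SU(N)` window of Theorem 1.2 (2) in the two spellings used by the tree:
`|β| < szzThresholdSU d ↔ |β| < 1/(16(d-1))`. [cite: ShenZhuZhuCMP2023, (1.3)] -/
theorem abs_lt_szzThresholdSU_iff {d : ℕ} (β : ℝ) :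
    |β| < szzThresholdSU d ↔ |β| < 1 / (16 * ((d : ℝ) - 1)) := Iff.rfl

end Literature.MathematicalPhysics.QuantumFieldTheory
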